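import Summits.ResolutionOfSingularities.ResolutionOfSingularities.Theorems.AbsoluteContactAxes
import Literature.AlgebraicGeometry.Resolution.TruncatedHasseSchmidt
import Literature.AlgebraicGeometry.Resolution.HasseSchmidtDiffEqDiffOp
import Literature.AlgebraicGeometry.Resolution.HasseSystemOfFormallySmooth
import Literature.AlgebraicGeometry.Resolution.QuasiRegularSequences
import Literature.AlgebraicGeometry.Resolution.RegularSystemOfParameters
import HarnessLib

/-!
# AbsoluteQFrameLinearPart — decomp-res node «AbsoluteContactInsep» (lens-6 g18), tree file 1/10 of the node

Content VERBATIM from the decomp-res lens-6 g18 file `HOME/decomp-res-lens-6/g18/AbsoluteContactInsep.lean` (sha256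
3771488be5d3cd2c, 1966 l; HOME =
run/shared/lean/pub/decomp-res).  Critic: CRITIC-LEDGER row 139 (CLEARED 2026-08-30T20:11:48Z, DECIDED +1:
`AbsContactOff3` proved for every p ≠ 3 and every
field, hypothesis-free); split per the lens's NODE-g18 §8 writer package (sections kept whole; two packages halved
for the 400-line limit).  Landed by
decomp-res writer g7 in the lens's namespace `…Theorems.AbsoluteContactClasses` (cone-free chain); the wiring
`Theorems/MaxContactCutAbsContactOff3`
(`agAbsContactOff3 : AGAbsContactOff3`, item 27752) follows the chain.  No new aside, nothing superseded; asides
31574 / 27753 / 27896 are ⟺ each other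
hypothesis-free by this node.

Section `LinearPart` (l. 121–393): linear parts / Taylor data of truncated Hasse–Schmidt systems (`taylorHom`, …).

[WRITER NOTE (decomp-res writer g7): file split only; namespace, opens, section variables and every declaration
exactly as in the lens (global `set_option` dropped).]

(Sources: Giraud1975; EGA IV 16.11.2, 0_IV 21.9; KimuraNiitsuma1980 Thm 3.4; EncinasVillamayor2000 Thm 4.9;
BravoGarciaEscamillaVillamayor2012 Lemma 4.6; Hironaka1964; CossartJannsenSaito2020; CossartPiltant2019; Kunz1969.)
-/

noncomputable section

open CategoryTheory AlgebraicGeometry TopologicalSpace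
open Literature.AlgebraicGeometry.Resolution
open Summit.ResolutionOfSingularities.ResolutionOfSingularities.Theorems
open WeakOrderReduction ForcedTowerClasses PurityValveClasses
open SatelliteExitClasses
open IsLocalRing MvPolynomial

namespace Summit.ResolutionOfSingularities.ResolutionOfSingularities.Theorems.AbsoluteContactClasses

section LinearPart

variable {O : Type*} [CommRing O] {d b : ℕ}

/-- The `u`-monomial `∏ i, u i ^ β i`. -/
def uMon (u : Fin d → O) (β : Fin d →₀ ℕ) : O := ∏ i, u i ^ β i

/-- `uMon_eq_eval`: Auxiliary step of this node's calculus, VERBATIM from the lens file (see the module docstring);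
the statement is its type. [folklore] -/
theorem uMon_eq_eval (u : Fin d → O) (β : Fin d →₀ ℕ) : uMon u β = eval u (monomial β 1) := by
  rw [eval_monomial, one_mul, Finsupp.prod_fintype _ _ (fun i => pow_zero _)]; rfl

/-- `uMon_mem_pow`: Auxiliary step of this node's calculus, VERBATIM from the lens file (see the module docstring);
the statement is its type. [folklore] -/
theorem uMon_mem_pow (u : Fin d → O) (β : Fin d →₀ ℕ) :
    uMon u β ∈ Ideal.span (Set.range u) ^ β.degree := by
  rw [uMon_eq_eval]
  exact eval_mem_span_pow u (isHomogeneous_monomial _ rfl)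

variable (ψ : O →ₐ[ℤ] MvPolynomial (Fin d) O ⧸ idealOfVars (Fin d) O ^ b) (u : Fin d → O)

/-- Exact values of the truncated Taylor coefficients on `u`-monomials, for a truncated
Hasse–Schmidt map with `ψ(u_i) = u_i + X_i`. (Sources: EGAIV4, 16.11.2.) -/
theorem hsCoeff_uMon (hψu : ∀ i, ψ (u i) = Ideal.Quotient.mk _ (C (u i) + X i))
    (β α : Fin d →₀ ℕ) (hα : α.degree < b) :
    TruncPoly.hsCoeff b ψ α (uMon u β) = eval u (hasseDeriv O α (monomial β 1)) := by
  classical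
  rw [TruncPoly.hsCoeff_apply, uMon, map_prod]
  simp_rw [map_pow, hψu, ← map_pow, ← map_prod]
  rw [TruncPoly.truncCoeff_mk_of_lt hα, coeff_prod_C_add_X_pow]

/-- `hsCoeff_uMon_mem_pow`: Auxiliary step of this node's calculus, VERBATIM from the lens file (see the module
docstring); the statement is its type. [folklore] -/
theorem hsCoeff_uMon_mem_pow (hψu : ∀ i, ψ (u i) = Ideal.Quotient.mk _ (C (u i) + X i))
    (β α : Fin d →₀ ℕ) (hα : α.degree < b) :
    TruncPoly.hsCoeff b ψ α (uMon u β) ∈ Ideal.span (Set.range u) ^ (β.degree - α.degree) := by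
  classical
  rw [hsCoeff_uMon ψ u hψu β α hα]
  by_cases hle : α ≤ β
  · rw [hasseDeriv_monomial, map_mul, map_natCast, ← uMon_eq_eval]
    refine Ideal.mul_mem_left _ _ ?_
    have hdeg : (β - α).degree = β.degree - α.degree := by
      have h := congrArg Finsupp.degree (tsub_add_cancel_of_le hle)
      rw [map_add] at h
      omega
    rw [← hdeg]
    exact uMon_mem_pow u _
  · rw [hasseDeriv_monomial_eq_zero_of_not_le O hle, map_zero]
    exact zero_mem _

/-- `hsCoeff_zero_apply'`: Auxiliary step of this node's calculus, VERBATIM from the lens file (see the module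
docstring); the statement is its type. [folklore] -/
theorem hsCoeff_zero_apply' (hψ0 : ∀ g, TruncPoly.truncCoeff O (Fin d) b 0 (ψ g) = g) (g : O) :
    TruncPoly.hsCoeff b ψ 0 g = g := by
  rw [TruncPoly.hsCoeff_apply, hψ0]

/-- `hsCoeff_single_apply_u`: Auxiliary step of this node's calculus, VERBATIM from the lens file (see the module
docstring); the statement is its type. [folklore] -/
theorem hsCoeff_single_apply_u (hψu : ∀ i, ψ (u i) = Ideal.Quotient.mk _ (C (u i) + X i))
    (hb : 1 < b) (i j : Fin d) :
    TruncPoly.hsCoeff b ψ (Finsupp.single i 1) (u j) = if j = i then 1 else 0 := by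
  classical
  have hdeg : (Finsupp.single i 1 : Fin d →₀ ℕ).degree < b := by simpa using hb
  rw [TruncPoly.hsCoeff_apply, hψu, TruncPoly.truncCoeff_mk_of_lt hdeg, coeff_add, coeff_C, coeff_X]
  have h0 : (0 : Fin d →₀ ℕ) ≠ Finsupp.single i 1 := (Finsupp.single_ne_zero.mpr one_ne_zero).symm
  by_cases hij : j = i
  · subst hij; simp [h0]
  · have hne : Finsupp.single j 1 ≠ Finsupp.single i 1 := by
      rwa [Ne, Finsupp.single_left_inj one_ne_zero]
    simp [h0, hne, hij]

/-- Leibniz rule in degree one for the truncated Taylor coefficients. [folklore] -/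
theorem hsCoeff_single_mul (hb : 1 < b) (i : Fin d) (g h : O) :
    TruncPoly.hsCoeff b ψ (Finsupp.single i 1) (g * h) =
      TruncPoly.hsCoeff b ψ (Finsupp.single i 1) g * TruncPoly.hsCoeff b ψ 0 h +
        TruncPoly.hsCoeff b ψ 0 g * TruncPoly.hsCoeff b ψ (Finsupp.single i 1) h := by
  classical
  have hdeg : (Finsupp.single i 1 : Fin d →₀ ℕ).degree < b := by simpa using hb
  rw [TruncPoly.hsCoeff_mul ψ hdeg, Finsupp.antidiagonal_single, Finset.sum_map,
    Finset.Nat.antidiagonal_succ, Finset.sum_cons, Finset.Nat.antidiagonal_zero, Finset.sum_map,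
    Finset.sum_singleton]
  simp [add_comm]

/-- A natural number prime to the characteristic is a unit. [folklore] -/
theorem isUnit_natCast_of_not_dvd (p : ℕ) [Fact p.Prime] [CharP O p] {n : ℕ} (hn : ¬ p ∣ n) :
    IsUnit (n : O) := by
  have hcop : Nat.Coprime p n := (Nat.Prime.coprime_iff_not_dvd Fact.out).mpr hn
  obtain ⟨a, b', hab⟩ := Nat.isCoprime_iff_coprime.mpr hcop
  refine isUnit_iff_exists_inv.mpr ⟨(b' : O), ?_⟩
  have h := congrArg (fun z : ℤ => (z : O)) hab
  simp only [Int.cast_add, Int.cast_mul, Int.cast_natCast, Int.cast_one, CharP.cast_eq_zero,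
    mul_zero, zero_add] at h
  rw [mul_comm]; exact h

/-- **Linear-part lemma** (absolute, truncated): for a truncated Hasse–Schmidt map `ψ` with
constant term `id` and `ψ(u_i) = u_i + X_i`, `span u = 𝔪`, an element `h ∈ 𝔪^{N+1} ∖ 𝔪^{N+2}`
with `p ∤ N + 1` has a Taylor coefficient of order `N` in `𝔪 ∖ 𝔪²`. (Sources: EGAIV4 16.11.2; Giraud 1975
/ Cossart–Piltant 2019 Prop. 2.50 (the classical `p ∤ ν`
linear-part argument); own formalisation.) -/
theorem exists_hsCoeff_mem_not_mem_sq [IsLocalRing O] (p : ℕ) [Fact p.Prime] [CharP O p]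
    (hu : Ideal.span (Set.range u) = maximalIdeal O)
    (hψ0 : ∀ g, TruncPoly.truncCoeff O (Fin d) b 0 (ψ g) = g)
    (hψu : ∀ i, ψ (u i) = Ideal.Quotient.mk _ (C (u i) + X i))
    {N : ℕ} (hNb : N + 1 < b) {h : O} (h1 : h ∈ maximalIdeal O ^ (N + 1))
    (h2 : h ∉ maximalIdeal O ^ (N + 2)) (hpN : ¬ p ∣ N + 1) :
    ∃ α : Fin d →₀ ℕ, α.degree = N ∧ TruncPoly.hsCoeff b ψ α h ∈ maximalIdeal O ∧
      TruncPoly.hsCoeff b ψ α h ∉ maximalIdeal O ^ 2 := by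
  classical
  -- Step 1: `h = F(u)`, `F` a form of degree `N+1`, with a coefficient outside `𝔪`.
  obtain ⟨F, hF, hFh⟩ := exists_isHomogeneous_of_mem_span_pow u (N + 1) (hu ▸ h1)
  have hnz : ∃ β₀ ∈ F.support, F.coeff β₀ ∉ maximalIdeal O := by
    by_contra hcon
    push Not at hcon
    have hFK : F ∈ Ideal.map C (maximalIdeal O) := by
      rw [mem_map_C_iff]
      intro m
      by_cases hm : m ∈ F.support
      · exact hcon m hm
      · rw [notMem_support_iff.mp hm]; exact zero_mem _
    have := eval_mem_mul_span_pow u hF hFK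
    rw [hu, ← pow_succ', hFh] at this
    exact h2 this
  obtain ⟨β₀, hβ₀, hcβ₀⟩ := hnz
  have hβ₀deg : β₀.degree = N + 1 := by
    rw [Finsupp.degree_eq_weight_one]; exact hF (mem_support_iff.mp hβ₀)
  -- Step 2: an index `i` with `p ∤ β₀ i`.
  have hi : ∃ i, ¬ p ∣ β₀ i := by
    by_contra hcon
    push Not at hcon
    apply hpN
    rw [← hβ₀deg, Finsupp.degree_apply]
    exact Finset.dvd_sum fun i _ => hcon i
  obtain ⟨i, hpi⟩ := hi
  have hβ₀i : 1 ≤ β₀ i := Nat.one_le_iff_ne_zero.mpr (fun h0 => hpi (h0 ▸ dvd_zero p))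
  -- Step 3: `α := β₀ - e_i`.
  set α : Fin d →₀ ℕ := β₀ - Finsupp.single i 1 with hα
  have hαβ : α + Finsupp.single i 1 = β₀ := by
    apply tsub_add_cancel_of_le
    intro j
    by_cases hj : j = i
    · subst hj; simpa using hβ₀i
    · simp [Ne.symm hj]
  have hαdeg : α.degree = N := by
    have := congrArg Finsupp.degree hαβ
    rw [map_add, hβ₀deg, Finsupp.degree_single] at this
    omega
  have hαb : α.degree < b := by omega
  set Δ := TruncPoly.hsCoeff b ψ with hΔ
  refine ⟨α, hαdeg, ?_, ?_⟩
  · -- Step 4: `Δ_α h ∈ 𝔪`.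
    rw [← hFh, F.as_sum, map_sum, map_sum]
    refine Submodule.sum_mem _ fun β hβ => ?_
    have hβdeg : β.degree = N + 1 := by
      rw [Finsupp.degree_eq_weight_one]; exact hF (mem_support_iff.mp hβ)
    have hmon : eval u (monomial β (coeff β F)) = coeff β F * uMon u β := by
      rw [eval_monomial, uMon, Finsupp.prod_fintype _ _ (fun i => pow_zero _)]
    rw [hmon, hΔ, TruncPoly.hsCoeff_mul ψ hαb]
    refine Submodule.sum_mem _ fun e he => Ideal.mul_mem_left _ _ ?_
    have hed : e.2.degree ≤ N := by
      have := congrArg Finsupp.degree (Finset.HasAntidiagonal.mem_antidiagonal.mp he)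
      rw [map_add, hαdeg] at this; omega
    have hmem := hsCoeff_uMon_mem_pow ψ u hψu β e.2 (by omega)
    rw [hu] at hmem
    have := Ideal.pow_le_pow_right (I := maximalIdeal O) (by omega : 1 ≤ β.degree - e.2.degree) hmem
    rwa [pow_one] at this
  · -- Step 5: `Δ_α h ∉ 𝔪²`: isolate the `e = (0, α)` part `S₀`, apply `Δ_{e_i}`.
    intro hsq
    have hb1 : 1 < b := by omega
    have hmon : ∀ β, eval u (monomial β (coeff β F)) = coeff β F * uMon u β := fun β => by
      rw [eval_monomial, uMon, Finsupp.prod_fintype _ _ (fun i => pow_zero _)]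
    have hβdeg : ∀ β ∈ F.support, β.degree = N + 1 := fun β hβ => by
      rw [Finsupp.degree_eq_weight_one]; exact hF (mem_support_iff.mp hβ)
    -- the remainder terms
    set rest : (Fin d →₀ ℕ) → O := fun β =>
      ∑ e ∈ (Finset.HasAntidiagonal.antidiagonal α).erase (0, α), Δ e.1 (coeff β F) * Δ e.2 (uMon u β) with hrest
    set S₀ : O := ∑ β ∈ F.support, coeff β F * Δ α (uMon u β) with hS₀
    have h0α : ((0 : Fin d →₀ ℕ), α) ∈ Finset.HasAntidiagonal.antidiagonal α :=
      Finset.HasAntidiagonal.mem_antidiagonal.mpr (zero_add α)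
    have hsplit : Δ α h = S₀ + ∑ β ∈ F.support, rest β := by
      conv_lhs => rw [← hFh, F.as_sum, map_sum, map_sum]
      rw [hS₀, ← Finset.sum_add_distrib]
      refine Finset.sum_congr rfl fun β hβ => ?_
      rw [hmon, hΔ, TruncPoly.hsCoeff_mul ψ hαb, ← Finset.add_sum_erase _ _ h0α,
        hsCoeff_zero_apply' ψ hψ0]
    have hrest_mem : ∀ β ∈ F.support, rest β ∈ maximalIdeal O ^ 2 := by
      intro β hβ
      refine Submodule.sum_mem _ fun e he => Ideal.mul_mem_left _ _ ?_
      obtain ⟨hne, he'⟩ := Finset.mem_erase.mp he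
      have hsum := Finset.HasAntidiagonal.mem_antidiagonal.mp he'
      have he1 : e.1 ≠ 0 := by
        intro h0
        apply hne
        rw [h0, zero_add] at hsum
        exact Prod.ext h0 hsum
      have hed : e.2.degree + 2 ≤ N + 1 := by
        have h' := congrArg Finsupp.degree hsum
        rw [map_add, hαdeg] at h'
        have : e.1.degree ≠ 0 := fun h0 => he1 ((Finsupp.degree_eq_zero_iff _).mp h0)
        omega
      have hmem := hsCoeff_uMon_mem_pow ψ u hψu β e.2 (by omega)
      rw [hu, hβdeg β hβ] at hmem
      exact Ideal.pow_le_pow_right (by omega) hmem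
    have hS₀mem : S₀ ∈ maximalIdeal O ^ 2 := by
      have : S₀ = Δ α h - ∑ β ∈ F.support, rest β := by rw [hsplit]; ring
      rw [this]
      exact sub_mem hsq (Submodule.sum_mem _ hrest_mem)
    -- apply the first-order operator `Δ_{e_i}`
    set Δ₁ := Δ (Finsupp.single i 1) with hΔ₁
    have hD₁ : IsDiffOpLE ℤ 1 Δ₁ :=
      TruncPoly.isDiffOpLE_hsCoeff ψ hψ0 1 _ (by simp) hb1
    have hΔ₁S₀ : Δ₁ S₀ ∈ maximalIdeal O := by
      simpa using hD₁.apply_mem_pow_sub (maximalIdeal O) 2 hS₀mem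
    -- evaluate `Δ₁ S₀` modulo `𝔪`
    have hval : ∀ β ∈ F.support, β ≠ β₀ → Δ₁ (Δ α (uMon u β)) = 0 := by
      intro β hβ hne
      rw [hΔ, hsCoeff_uMon ψ u hψu β α hαb]
      by_cases hle : α ≤ β
      · rw [hasseDeriv_monomial, map_mul, map_natCast, ← uMon_eq_eval, ← nsmul_eq_mul, map_nsmul,
          hsCoeff_uMon ψ u hψu _ _ (by simpa using hb1)]
        by_cases hle' : Finsupp.single i 1 ≤ β - α
        · exfalso; apply hne
          have hγ : (β - α).degree = 1 := by
            have h' := congrArg Finsupp.degree (tsub_add_cancel_of_le hle)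
            rw [map_add, hαdeg, hβdeg β hβ] at h'
            omega
          have hγ' : β - α = Finsupp.single i 1 := by
            have hs := (tsub_add_cancel_of_le hle').symm
            have h' := congrArg Finsupp.degree hs
            rw [map_add, hγ, Finsupp.degree_single] at h'
            have h0 : β - α - Finsupp.single i 1 = 0 :=
              (Finsupp.degree_eq_zero_iff _).mp (by omega)
            rw [h0, zero_add] at hs
            exact hs
          rw [← tsub_add_cancel_of_le hle, hγ', add_comm]
          exact hαβ
        · rw [hasseDeriv_monomial_eq_zero_of_not_le O hle', map_zero, smul_zero]
      · rw [hasseDeriv_monomial_eq_zero_of_not_le O hle, map_zero, map_zero]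
    have hval₀ : Δ₁ (Δ α (uMon u β₀)) = (β₀ i : O) := by
      rw [hΔ, hsCoeff_uMon ψ u hψu β₀ α hαb, hasseDeriv_monomial, map_mul, map_natCast,
        ← uMon_eq_eval, ← nsmul_eq_mul, map_nsmul]
      have hγ : β₀ - α = Finsupp.single i 1 := by
        rw [← hαβ, add_tsub_cancel_left]
      have hu1 : uMon u (β₀ - α) = u i := by
        rw [hγ, uMon, Finset.prod_eq_single i (fun j _ hj => by
          simp [hj]) (fun h => (h (Finset.mem_univ _)).elim)]
        simp
      rw [hu1, hΔ₁, hΔ, hsCoeff_single_apply_u ψ u hψu hb1, if_pos rfl, nsmul_eq_mul, mul_one]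
      congr 1
      rw [Finset.prod_eq_single i (fun l _ hl => ?_) (fun hi' => ?_)]
      · have : α i = β₀ i - 1 := by
          have := congrArg (fun γ => γ i) hαβ; simp at this; omega
        rw [this, Nat.choose_symm hβ₀i, Nat.choose_one_right]
      · have : α l = β₀ l := by
          have := congrArg (fun γ => γ l) hαβ
          simpa [Finsupp.single_apply, hl, Ne.symm hl] using this
        rw [this, Nat.choose_self]
      · have hαi : α i = 0 := by simpa using hi'
        have : β₀ i = 1 := by
          have := congrArg (fun γ => γ i) hαβ; simp at this; omega
        rw [this, hαi, Nat.choose_zero_right]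
    have hT : Δ₁ S₀ = ∑ β ∈ F.support, (Δ₁ (coeff β F) * Δ α (uMon u β) +
        coeff β F * Δ₁ (Δ α (uMon u β))) := by
      rw [hS₀, map_sum]
      refine Finset.sum_congr rfl fun β hβ => ?_
      rw [hΔ₁, hΔ, hsCoeff_single_mul ψ hb1, hsCoeff_zero_apply' ψ hψ0, hsCoeff_zero_apply' ψ hψ0]
    have hfirst : ∀ β ∈ F.support, Δ₁ (coeff β F) * Δ α (uMon u β) ∈ maximalIdeal O := by
      intro β hβ
      refine Ideal.mul_mem_left _ _ ?_
      have hmem := hsCoeff_uMon_mem_pow ψ u hψu β α hαb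
      rw [hu, hβdeg β hβ, hαdeg, show N + 1 - N = 1 by omega, pow_one] at hmem
      exact hmem
    have hsecond : ∑ β ∈ F.support, coeff β F * Δ₁ (Δ α (uMon u β)) = coeff β₀ F * (β₀ i : O) := by
      rw [Finset.sum_eq_single_of_mem β₀ hβ₀ (fun β hβ hne => by rw [hval β hβ hne, mul_zero]), hval₀]
    have hkey : coeff β₀ F * (β₀ i : O) ∈ maximalIdeal O := by
      rw [← hsecond]
      have : ∑ β ∈ F.support, coeff β F * Δ₁ (Δ α (uMon u β)) =
          Δ₁ S₀ - ∑ β ∈ F.support, Δ₁ (coeff β F) * Δ α (uMon u β) := by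
        rw [hT, Finset.sum_add_distrib]; ring
      rw [this]
      exact sub_mem hΔ₁S₀ (Submodule.sum_mem _ hfirst)
    exact hcβ₀ ((Ideal.mul_unit_mem_iff_mem _ (isUnit_natCast_of_not_dvd p hpi)).mp hkey)

end LinearPart

end Summit.ResolutionOfSingularities.ResolutionOfSingularities.Theorems.AbsoluteContactClasses
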